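import Literature.Geometry.Riemannian.HeatKernelGradientPropertyZero
import Literature.Geometry.Riemannian.HeatKernelDuality
import Literature.Geometry.Riemannian.ConjugateHeatPositivity
import Literature.Geometry.Lorentzian.VolumePositivity
import HarnessLib

/-!
# The heat kernel measures of a Ricci flow have full support (Bamler 2020a, §2.3: `K > 0`)

R. Bamler, *Entropy and heat kernel bounds on a Ricci flow background*, arXiv:2008.07093 (2020a),
§2.3: the heat kernel `K(x,t;y,s)`, `s < t`, of a Ricci flow on a closed manifold is positive, so
the conjugate heat kernel measures `dν_{x,t;s} = K(x,t;·,s) dg_s` charge every nonempty open set.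
The tree has the measures `ν_{x,t;s}` (`heatKernelMeasure`, `HeatKernelMeasures.lean`, built
WITHOUT a density) of a `C^∞` family `h` of Riemannian metrics on a closed manifold `M` (modelled
on `ℝᵐ`) which is a Ricci flow on `[s, t]`. This file PROVES, for connected `M`, that
`supp ν_{x,t;s} = M` for EVERY `x`, in the strong form "every Borel set of positive
`V_{h(s)}`-volume has positive `ν_{x,t;s}`-mass":

* `IsRicciFlow.heatKernelMeasure_apply_eq_zero_forall_of_exists` — if `ν_{x₀,t;s}(S) = 0` for one
  `x₀` then `ν_{x,t;s}(S) = 0` for all `x` (the zero propagation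
  `IsRicciFlow.integral_heatKernelMeasure_eq_zero_of_exists` of
  `HeatKernelGradientPropertyZero.lean`, i.e. Bamler's gradient estimate, for the datum `𝟙_S`);
* `IsRicciFlow.lintegral_heatKernelMeasure_apply_riemVolume` —
  `∫ ν_{x,t;s}(S) dV_{h(t)}(x) = ∫_S v dV_{h(s)}` with `v` continuous and `> 0` (the averaged
  identity `IsRicciFlow.bind_heatKernelMeasure_withDensity_eq` of `HeatKernelDuality.lean` with
  `ψ = 1`, whose conjugate heat solution is positive, `ConjugateHeatPositivity.lean`);
* `IsRicciFlow.heatKernelMeasure_pos_of_riemVolume_pos`,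
  `IsRicciFlow.heatKernelMeasure_pos_of_isOpen` — **`V_{h(s)}(S) > 0 ⟹ ν_{x,t;s}(S) > 0` for
  every `x`**, in particular for every nonempty open `S` (`isOpenPosMeasure_riemannianMeasure`,
  `VolumePositivity.lean`).

Everything is proved; no definitions, no named facts. NOT here: the pointwise positivity of the
density `K(x,t;·,s)` itself (which needs its continuity).

## References

* R. H. Bamler, *Entropy and heat kernel bounds on a Ricci flow background*, arXiv:2008.07093
  (2020), §2.3 (heat kernel `K > 0`, conjugate heat kernel measures `ν_{x,t;s}`).
  [Bamler2020Entropy]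
* R. H. Bamler, *Compactness theory of the space of super Ricci flows*, Invent. Math. 233 (2023),
  1121–1277, §3.1 Def. 3.2 (6), §3.7. [Bamler2023]
-/

noncomputable section

namespace Literature.Geometry.Riemannian

open Lorentzian Lorentzian.PseudoRiemannianMetric _root_.MeasureTheory _root_.MeasureTheory.Measure
  _root_.Set _root_.Filter
open scoped _root_.ENNReal _root_.Topology _root_.Manifold _root_.ContDiff

section FullSupport

variable {m : ℕ} {H : Type*} [TopologicalSpace H]
  {I : ModelWithCorners ℝ (EuclideanSpace ℝ (Fin m)) H} [I.Boundaryless]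
  {M : Type*} [TopologicalSpace M] [ChartedSpace H M] [IsManifold I ∞ M]
  [T2Space M] [CompactSpace M] [SecondCountableTopology M] [MeasurableSpace M] [BorelSpace M]
  {h : ℝ → PseudoRiemannianMetric I ∞ (EuclideanSpace ℝ (Fin m)) (TangentSpace I : M → Type _)}
  {cov : ℝ → CovariantDerivative I (EuclideanSpace ℝ (Fin m)) (TangentSpace I : M → Type _)}
  (hh : IsContMDiffFamilyOn ∞ h univ) (hR : ∀ r, (h r).IsRiemannian)

/-- **`ν`-null sets do not depend on the base point** (Bamler 2020a, §2.3, `K > 0`, in measure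
form): on a closed connected `M` carrying a `C^∞` family `h` of Riemannian metrics which is a Ricci
flow on `[s, t]`, `s < t`, a Borel set `S` with `ν_{x₀,t;s}(S) = 0` for one `x₀` has
`ν_{x,t;s}(S) = 0` for every `x` (zero propagation
`IsRicciFlow.integral_heatKernelMeasure_eq_zero_of_exists` for the datum `𝟙_S`).
[cite: Bamler2020Entropy, §2.3] -/
theorem IsRicciFlow.heatKernelMeasure_apply_eq_zero_forall_of_exists [PreconnectedSpace M]
    {s t : ℝ} (hst : s < t) (hflow : IsRicciFlow h cov (Icc s t)) {S : Set M}
    (hS : MeasurableSet S) {x₀ : M} (hx₀ : heatKernelMeasure hh hR t x₀ s S = 0) (x : M) :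
    heatKernelMeasure hh hR t x s S = 0 := by
  have hum : Measurable (S.indicator (1 : M → ℝ)) := measurable_one.indicator hS
  have hu01 : ∀ y, S.indicator (1 : M → ℝ) y ∈ Icc (0 : ℝ) 1 := fun y ↦ by
    by_cases hy : y ∈ S <;> simp [hy]
  have h0 : ∫ z, S.indicator (1 : M → ℝ) z ∂(heatKernelMeasure hh hR t x₀ s) = 0 := by
    rw [integral_indicator_one hS, measureReal_def, hx₀, ENNReal.toReal_zero]
  have key := hflow.integral_heatKernelMeasure_eq_zero_of_exists hh hR hst hum hu01 h0 x
  rw [integral_indicator_one hS, measureReal_def, ENNReal.toReal_eq_zero_iff] at key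
  exact key.resolve_right (measure_ne_top _ _)

/-- **The `V_{h(t)}`-average of `x ↦ ν_{x,t;s}(S)` is `∫_S v dV_{h(s)}` for a continuous `v > 0`**
(Bamler 2020a, §2.3: `∫ K(x,t;·,s) dg_t(x)` solves the conjugate heat equation with final value
`1`): for a Ricci flow on `[s, t]`, `s < t`, and a Borel set `S`,
`∫ ν_{x,t;s}(S) dV_{h(t)}(x) = ∫_S v(s, ·) dV_{h(s)}` where `v` is the conjugate heat solution on
`M × [s, t]` with `v(t) = 1` (`IsRicciFlow.bind_heatKernelMeasure_withDensity_eq` with `ψ = 1`),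
which is continuous and strictly positive (`IsRicciFlow.pos_of_isConjugateHeatSolutionOn`).
[cite: Bamler2020Entropy, §2.3] -/
theorem IsRicciFlow.lintegral_heatKernelMeasure_apply_riemVolume {s t : ℝ} (hst : s < t)
    (hflow : IsRicciFlow h cov (Icc s t)) {S : Set M} (hS : MeasurableSet S) :
    ∃ v : M → ℝ, Continuous v ∧ (∀ y, 0 < v y) ∧
      ∫⁻ x, heatKernelMeasure hh hR t x s S ∂(h t).riemVolume =
        ∫⁻ y in S, ENNReal.ofReal (v y) ∂(h s).riemVolume := by
  -- the conjugate heat solution with final value `1`, built on `[0, t - s]` and translated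
  have hT : 0 < t - s := sub_pos.2 hst
  have hflow' : IsRicciFlow (fun r ↦ h (r + s)) (fun r ↦ cov (r + s)) (Icc 0 (t - s)) := by
    refine (hflow.comp_add_const s).mono fun r hr ↦ ?_
    exact ⟨by linarith [hr.1], by linarith [hr.2]⟩
  have hR' : ∀ r ∈ Icc (0 : ℝ) (t - s), (h (r + s)).IsRiemannian := fun r _ ↦ hR (r + s)
  obtain ⟨u, huT, hu⟩ := hflow'.exists_isConjugateHeatSolutionOn_Icc hT hR' (fun _ ↦ (1 : ℝ))
    contMDiff_const
  have hupos : ∀ r ∈ Icc (0 : ℝ) (t - s), ∀ y, 0 < u r y :=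
    hflow'.pos_of_isConjugateHeatSolutionOn hT hR' hu fun y ↦ by rw [huT]; exact one_pos
  have hv : IsConjugateHeatSolutionOn h cov (Icc s t) fun r ↦ u (r - s) := by
    have key := hu.comp_sub_const (h := h) (cov := cov) hT
    simp only [zero_add, sub_add_cancel] at key
    exact key
  have hvt : (fun r ↦ u (r - s)) t = fun _ ↦ (1 : ℝ) := huT
  have hv0 : ∀ r ∈ Icc s t, ∀ y, 0 ≤ (fun r ↦ u (r - s)) r y := fun r hr y ↦
    (hupos (r - s) ⟨by linarith [hr.1], by linarith [hr.2]⟩ y).le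
  -- the averaged identity with `ψ = 1`, evaluated on `S`
  have key := hflow.bind_heatKernelMeasure_withDensity_eq hh hR hst contMDiff_const
    (fun _ ↦ zero_le_one) hv hvt hv0
  simp only [ENNReal.ofReal_one] at key
  rw [show (fun _ : M ↦ (1 : ℝ≥0∞)) = 1 from rfl, withDensity_one] at key
  have hs0 : s - s ∈ Icc (0 : ℝ) (t - s) := ⟨(sub_self s).ge, (sub_self s).trans_le hT.le⟩
  refine ⟨fun y ↦ u (s - s) y, (contMDiff_slice_of_contMDiffOn hu.1 hs0).continuous,
    fun y ↦ hupos (s - s) hs0 y, ?_⟩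
  rw [← Measure.bind_apply hS (measurable_heatKernelMeasure hh hR t s).aemeasurable, key,
    withDensity_apply _ hS]

/-- **`ν_{x,t;s}` charges every set of positive volume** (Bamler 2020a, §2.3: the heat kernel
`K(x,t;y,s)`, `s < t`, is positive): on a closed connected `M` carrying a `C^∞` family `h` of
Riemannian metrics which is a Ricci flow on `[s, t]`, `s < t`, every Borel set `S` with
`V_{h(s)}(S) > 0` has `ν_{x,t;s}(S) > 0` for EVERY `x` (if `ν_{x,t;s}(S) = 0` for one `x` then for
all `x`, so `∫ ν_{x,t;s}(S) dV_{h(t)}(x) = ∫_S v dV_{h(s)} = 0` with `v > 0` continuous, forcing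
`V_{h(s)}(S) = 0`). [cite: Bamler2020Entropy, §2.3] -/
theorem IsRicciFlow.heatKernelMeasure_pos_of_riemVolume_pos [PreconnectedSpace M] {s t : ℝ}
    (hst : s < t) (hflow : IsRicciFlow h cov (Icc s t)) {S : Set M} (hS : MeasurableSet S)
    (hSpos : 0 < (h s).riemVolume S) (x : M) : 0 < heatKernelMeasure hh hR t x s S := by
  obtain ⟨v, hvc, hvpos, hvS⟩ := hflow.lintegral_heatKernelMeasure_apply_riemVolume hh hR hst hS
  refine pos_iff_ne_zero.2 fun hx0 ↦ ?_
  have hall : ∀ x', heatKernelMeasure hh hR t x' s S = 0 :=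
    hflow.heatKernelMeasure_apply_eq_zero_forall_of_exists hh hR hst hS hx0
  simp only [hall, lintegral_zero] at hvS
  have hsupp : Function.support (fun y ↦ ENNReal.ofReal (v y)) = univ :=
    eq_univ_of_forall fun y ↦ (ENNReal.ofReal_pos.2 (hvpos y)).ne'
  have hpos : 0 < ∫⁻ y in S, ENNReal.ofReal (v y) ∂(h s).riemVolume :=
    (setLIntegral_pos_iff hvc.measurable.ennreal_ofReal).2 (by rwa [hsupp, univ_inter])
  exact hpos.ne' hvS.symm

/-- **`ν_{x,t;s}` has full support** (Bamler 2020a, §2.3, `K > 0`): on a closed connected `M`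
carrying a `C^∞` family of Riemannian metrics which is a Ricci flow on `[s, t]`, `s < t`, every
nonempty open `U ⊆ M` has `ν_{x,t;s}(U) > 0` for every `x` (the Riemannian measure `V_{h(s)}`
charges nonempty open sets, `isOpenPosMeasure_riemannianMeasure`).
[cite: Bamler2020Entropy, §2.3] -/
theorem IsRicciFlow.heatKernelMeasure_pos_of_isOpen [PreconnectedSpace M] {s t : ℝ} (hst : s < t)
    (hflow : IsRicciFlow h cov (Icc s t)) {U : Set M} (hU : IsOpen U) (hUne : U.Nonempty)
    (x : M) : 0 < heatKernelMeasure hh hR t x s U := by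
  have hUpos : 0 < (h s).riemVolume U := by
    rw [riemVolume_eq (hR s)]
    haveI := isOpenPosMeasure_riemannianMeasure ((h s).toContMDiffRiemannianMetric (hR s))
    exact hU.measure_pos _ hUne
  exact hflow.heatKernelMeasure_pos_of_riemVolume_pos hh hR hst hU.measurableSet hUpos x

end FullSupport

end Literature.Geometry.Riemannian

end
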